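/-
Copyright (c) 2026 the pub-hodgecm-mathlib formalisation cell (harness21).  Prover seat hodgecm-mathlib-LH3-p01 (g7): LH4-plan (g6) WORD #107 sequel of (P3d)
«UnitRowTraceValue» — the engine-free VALUE twins over the trace frame `Q_b`; 2026-09-02.
-/
import Literature.NumberTheory.Rogawski1990.DepthZeroKappaTransferTypeOneUnitRowTrace   -- ★ (P3d): `isRegularElt∕compactSpace_centralizer∕deep_of_congr_traceTorusElt{,Pi}` (+ the ★ `e = ½` sibling and ★ O8b it imports)
import HarnessLib

/-!
# The depth-zero κ-transfer, type (1): the VALUE of a depth-zero piece at the trace literals `t_π^{(b)}(x₁,x₂,x₃)` and `t_1^{(b)}(x₁,x₂,x₃)` — NO `2e = 1`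
# (Rogawski 1990 Prop. 4.9.1; Kottwitz 1986 §3; Flicker 1998 §2 Prop. 3)

Topic `NumberTheory/Rogawski1990`; namespace `Literature.NumberTheory.Rogawski1990`.  THEOREMS ONLY (no definition, no instance, no notation, no named fact,
no `sorry`); count-neutral; kernel lane `--supports stmt-HodgeConjecture-24833`.  Cell `pub/hodgecm-mathlib`, crux H413 = `stmt-HodgeConjecture-24833`, half A line LH4
(dyadic pay-down; (D-UNR) PRINT by ruling D74′), LEAD T13-42 (4) price list, LH4-plan (g6) WORD #107 (sequel of (P3d), M1 «Flicker scalars» re-base, FINDING OF RECORD #4,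
`F0/P3c/LH4/LH4-p01/g6/CENSUS-M1-flicker-scalars.v1.md` bf2b9cff §3 row #11; item (C) of F0P3a-p08's (P3f) census, gating the G-side-modulo-counts file).

THIS FILE is the twin of the two ENGINE-FREE value lemmas ★ `DepthZeroKappaTransferTypeOneUnitRow` :326 `classOrbitalIntegral_eq_mul_strata_of_congr_flickerTorusElt` and
:599 `classOrbitalIntegral_eq_mul_strata_of_congr_flickerTorusEltOne`: ★ O8b `classOrbitalIntegral_eq_mul_strata_three_of_deep` with its three inputs (`hreg`, compact
centraliser, `ht`) discharged — here by the (P3d) trace-frame lemmas ★ `isRegularElt_of_congr_traceTorusElt{,Pi}`, ★ `compactSpace_centralizer_of_congr_traceTorusElt{,Pi}`,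
★ `deep_of_congr_traceTorusElt{,Pi}` — for `t ∈ G′_v = U(H′)(L⁺_v)` carried by a congruence `ψ g = Tl g Tl⁻¹` onto a TRACE LITERAL of ★ p851724 `FlickerTorusTraceFrame`
(`t_π^{(b)} = (x₁σb + x₃b, 0, π(x₁ − x₃); 0, x₂, 0; π′·bσb(x₁ − x₃), 0, x₁b + x₃σb)`, `t_1^{(b)}` = the same with `π = π′ = 1` dropped; `σ = conjLocal`, `b + σb = 1`) whose
eigenvalues are norm-one, pairwise distinct and ≡ 1 (mod 𝔪_w): `Φ(⟦t⟧, g) = ν_G(K_v) · (c₀ n₀(t) + c₁ n₁(t) + c₂ n₂(t))`.  The binder `h2e : 2 * e = 1` of ★ is DELETED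
(replaced by `hb : b + σb = 1`); statements otherwise byte-identical to ★; proofs verbatim (three inputs, one `exact`).  Nothing reads `2`, `e`, `x`, `y`, `|2|`.

NOT HERE (engine, LAYER B of the census, FINDING #6): the unit-row strata SUMS `n₀ + n₁ + n₂ = φ₁ ∕ φ₀` (★ :211 ∕ :497), which call the Flicker count engine in the corner frame.

HONEST READER LABEL: BANKED value layer, consumers none live yet (the M1 re-base of `DepthZeroKappaTransferTypeOneAt`∕`…GSide`∕`…Socket` is undealt); HC_CM is proved only
modulo the 7 printed citations (2 remaining named inputs: hLiu418 = stmt-HodgeConjecture-24832, h413 = stmt-HodgeConjecture-24833) until rung 0 closes; count-neutral,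
pays no organ, opens no road.

## References
* [Rogawski1990] J. D. Rogawski, *Automorphic Representations of Unitary Groups in Three Variables* (1990), §4.9 p. 54, Prop. 4.9.1 (b) p. 55, §14.2 p. 233.
* [Kottwitz1986] R. E. Kottwitz, *Base change for unit elements of Hecke algebras*, Compositio Math. 60 (1986), §3.
* [Flicker1998UnitaryFL] Y. Z. Flicker, *Elementary proof of the fundamental lemma for a unitary group*, Canad. J. Math. 50 (1998), §2 Prop. 3 pp. 78–79.
* [Jacobowitz1962] R. Jacobowitz, *Hermitian forms over local fields*, Amer. J. Math. 84 (1962), §7 Thm. 7.1 (the trace condition `b + b̄ = 1`).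
-/

set_option autoImplicit false

noncomputable section

open MeasureTheory Measure Set Function NumberField IsDedekindDomain Matrix Polynomial
open Literature.NumberTheory.Automorphic Literature.NumberTheory.Automorphic.UnitaryGroup
open Literature.NumberTheory.Automorphic.IntegralReduction Literature.NumberTheory.GaloisRepresentations
open scoped Matrix MatrixGroups ValuativeRel

namespace Literature.NumberTheory.Rogawski1990

variable (L : Type) [Field L] [NumberField L] [IsCMField L] (H' : Matrix (Fin 3) (Fin 3) L)
  {v : HeightOneSpectrum (𝓞 ↥(maximalRealSubfield L))}

/-! ## §1 The value at a θ̄ = 1 trace literal `t_π^{(b)}(x₁, x₂, x₃)` -/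

/-- **THE VALUE OF A DEPTH-ZERO PIECE AT A θ̄ = 1 TRACE LITERAL**: ★ O8b `classOrbitalIntegral_eq_mul_strata_three_of_deep` with its three inputs (`hreg`, compact
centraliser, `ht`) discharged by the (P3d) trace-frame lemmas for `t` congruent to `t_π^{(b)}(x₁,x₂,x₃)` (`b + σb = 1`, `ππ′ = 1`) with norm-one, pairwise distinct
eigenvalues ≡ 1: `Φ(⟦t⟧, g) = ν_G(K_v) · (c₀ n₀(t) + c₁ n₁(t) + c₂ n₂(t))` — the `hΦ₂, hΦ₃, hΦ₄` of the socket ★ `finsum_finExplicitDelta_mul_classOrbitalIntegral_eq_of_split_of_strata`;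
twin of ★ `classOrbitalIntegral_eq_mul_strata_of_congr_flickerTorusElt` with NO `2e = 1`. [cite: Rogawski1990, §4.9 p. 54, Prop. 4.9.1 (b) p. 55] [cite: Kottwitz1986, §3]
[cite: Flicker1998UnitaryFL, §2 Prop. 3 pp. 78–79] -/
theorem classOrbitalIntegral_eq_mul_strata_of_congr_traceTorusEltPi
    (hH' : (H'.map (IsCMField.complexConj L))ᵀ = H') (hH'u : IsUnit H') (w : PlacesOver L v)
    (hw : IsCMField.complexConj L • w.1 = w.1)
    [MeasurableSpace ((cmDatum L 3 H').Local v)] [BorelSpace ((cmDatum L 3 H').Local v)]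
    [∀ γ : ((cmDatum L 3 H').Local v), MeasurableSpace (((cmDatum L 3 H').Local v) ⧸ Subgroup.centralizer ({γ} : Set ((cmDatum L 3 H').Local v)))]
    [∀ γ : ((cmDatum L 3 H').Local v), BorelSpace (((cmDatum L 3 H').Local v) ⧸ Subgroup.centralizer ({γ} : Set ((cmDatum L 3 H').Local v)))]
    (νG : Measure ((cmDatum L 3 H').Local v)) [νG.IsHaarMeasure] [νG.IsMulRightInvariant]
    {mG : OrbitalMeasureFamily ((cmDatum L 3 H').Local v)}
    (hmG : mG.IsCanonical (fun γ => IsRegularElt (γ.val : GL (Fin 3) (UnitaryGroup.LocalRing L v))) νG)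
    -- the depth-zero piece
    (g : ((cmDatum L 3 H').Local v) → ℂ) (hg : IsLocSmooth g) (hgK : tsupport g ⊆ (cmLocalIntegralLevel L 3 H' v : Set ((cmDatum L 3 H').Local v)))
    (hginv : ∀ u ∈ cmLocalIntegralLevel L 3 H' v, ∀ x, g (u * x * u⁻¹) = g x)
    (c : ℕ → ℂ)
    (hc : ∀ k ∈ cmLocalIntegralLevel L 3 H' v,
      (redMat (((k.val : GL (Fin 3) (UnitaryGroup.LocalRing L v)).val.map (Pi.evalRingHom (fun w' : PlacesOver L v => w'.1.adicCompletion L) w))) - 1) ^ 3 = 0 →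
      g k = c (redMat (((k.val : GL (Fin 3) (UnitaryGroup.LocalRing L v)).val.map (Pi.evalRingHom (fun w' : PlacesOver L v => w'.1.adicCompletion L) w))) - 1).rank)
    -- the trace literal
    {b π π' x₁ x₂ x₃ : LocalRing L v} (hb : b + conjLocal L (IsCMField.complexConj L) v b = 1) (hππ : π * π' = 1)
    (hx₁ : conjLocal L (IsCMField.complexConj L) v x₁ * x₁ = 1) (hx₂ : conjLocal L (IsCMField.complexConj L) v x₂ * x₂ = 1)
    (hx₃ : conjLocal L (IsCMField.complexConj L) v x₃ * x₃ = 1) (h₁₂ : x₁ ≠ x₂) (h₂₃ : x₂ ≠ x₃) (h₁₃ : x₁ ≠ x₃)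
    (Tl : GL (Fin 3) (LocalRing L v))
    (ψ : ↥(UnitaryGroup.«local» L (IsCMField.complexConj L) 3 H' v) ≃ₜ*
        ↥(UnitaryGroup.«local» L (IsCMField.complexConj L) 3 (Matrix.of fun i j : Fin 3 => if i.val + j.val + 1 = 3 then (1 : L) else 0) v))
    (t : (cmDatum L 3 H').Local v)
    (hψ : ∀ g, (ψ g).val = Tl * g.val * Tl⁻¹)
    (hlit : (ψ t).val.val = !![x₁ * conjLocal L (IsCMField.complexConj L) v b + x₃ * b, 0, π * (x₁ - x₃); 0, x₂, 0;
      π' * (b * conjLocal L (IsCMField.complexConj L) v b * (x₁ - x₃)), 0, x₁ * b + x₃ * conjLocal L (IsCMField.complexConj L) v b])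
    (hd₁ : Valued.v (x₁ w - 1) < 1) (hd₂ : Valued.v (x₂ w - 1) < 1) (hd₃ : Valued.v (x₃ w - 1) < 1) :
    classOrbitalIntegral mG g (ConjClasses.mk t) =
      (νG.real (cmLocalIntegralLevel L 3 H' v : Set ((cmDatum L 3 H').Local v)) : ℂ) *
        (c 0 * ({q : (cmDatum L 3 H').Local v ⧸ cmLocalIntegralLevel L 3 H' v |
            q ∈ MulAction.fixedBy ((cmDatum L 3 H').Local v ⧸ cmLocalIntegralLevel L 3 H' v) t ∧
              (redMat ((((q.out⁻¹ * t * q.out : (cmDatum L 3 H').Local v)).val : GL (Fin 3) (LocalRing L v)).val.map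
                (Pi.evalRingHom (fun w' : PlacesOver L v => w'.1.adicCompletion L) w)) - 1).rank = 0}.ncard : ℂ) +
          c 1 * ({q : (cmDatum L 3 H').Local v ⧸ cmLocalIntegralLevel L 3 H' v |
            q ∈ MulAction.fixedBy ((cmDatum L 3 H').Local v ⧸ cmLocalIntegralLevel L 3 H' v) t ∧
              (redMat ((((q.out⁻¹ * t * q.out : (cmDatum L 3 H').Local v)).val : GL (Fin 3) (LocalRing L v)).val.map
                (Pi.evalRingHom (fun w' : PlacesOver L v => w'.1.adicCompletion L) w)) - 1).rank = 1}.ncard : ℂ) +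
          c 2 * ({q : (cmDatum L 3 H').Local v ⧸ cmLocalIntegralLevel L 3 H' v |
            q ∈ MulAction.fixedBy ((cmDatum L 3 H').Local v ⧸ cmLocalIntegralLevel L 3 H' v) t ∧
              (redMat ((((q.out⁻¹ * t * q.out : (cmDatum L 3 H').Local v)).val : GL (Fin 3) (LocalRing L v)).val.map
                (Pi.evalRingHom (fun w' : PlacesOver L v => w'.1.adicCompletion L) w)) - 1).rank = 2}.ncard : ℂ)) := by
  have hH'c : (H'.map (cmConjRingHom L))ᵀ = H' := by
    have e1 : H'.map (cmConjRingHom L) = H'.map (IsCMField.complexConj L) := by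
      ext i j; simp [Matrix.map_apply, cmConjRingHom_apply]
    rw [e1]; exact hH'
  have hdet : H'.det ≠ 0 := (Matrix.isUnit_iff_isUnit_det _ |>.1 hH'u).ne_zero
  have hreg : IsRegularElt (t.val : GL (Fin 3) (LocalRing L v)) :=
    isRegularElt_of_congr_traceTorusEltPi L H' w hw hb hππ h₁₂ h₂₃ h₁₃ Tl ψ t hψ hlit
  haveI : CompactSpace (Subgroup.centralizer ({t} : Set ((cmDatum L 3 H').Local v))) :=
    compactSpace_centralizer_of_congr_traceTorusEltPi L H' hH' hH'u w hw hb hππ hx₁ hx₂ hx₃ h₁₂ h₂₃ h₁₃ Tl ψ t hψ hlit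
  have ht := deep_of_congr_traceTorusEltPi L H' w hb hππ Tl ψ t hψ hlit hd₁ hd₂ hd₃
  exact classOrbitalIntegral_eq_mul_strata_three_of_deep L v w hw νG hH'c hdet hmG t hreg ht g hg hgK hginv c hc

/-! ## §2 The value at a θ̄ = 0 trace literal `t_1^{(b)}(x₁, x₂, x₃)` -/

/-- **THE VALUE OF A DEPTH-ZERO PIECE AT A θ̄ = 0 TRACE LITERAL**: ★ O8b `classOrbitalIntegral_eq_mul_strata_three_of_deep` with its three inputs (`hreg`, compact
centraliser, `ht`) discharged by the (P3d) trace-frame lemmas for `t` congruent to `t_1^{(b)}(x₁,x₂,x₃)` (`b + σb = 1`) with norm-one, pairwise distinct eigenvalues ≡ 1: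
`Φ(⟦t⟧, g) = ν_G(K_v) · (c₀ n₀(t) + c₁ n₁(t) + c₂ n₂(t))` — the `hΦ₁` of the socket ★ `finsum_finExplicitDelta_mul_classOrbitalIntegral_eq_of_split_of_strata`; twin of ★
`classOrbitalIntegral_eq_mul_strata_of_congr_flickerTorusEltOne` with NO `2e = 1`. [cite: Rogawski1990, §4.9 p. 54, Prop. 4.9.1 (b) p. 55] [cite: Kottwitz1986, §3]
[cite: Flicker1998UnitaryFL, §2 Prop. 3 pp. 78–79] -/
theorem classOrbitalIntegral_eq_mul_strata_of_congr_traceTorusElt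
    (hH' : (H'.map (IsCMField.complexConj L))ᵀ = H') (hH'u : IsUnit H') (w : PlacesOver L v)
    (hw : IsCMField.complexConj L • w.1 = w.1)
    [MeasurableSpace ((cmDatum L 3 H').Local v)] [BorelSpace ((cmDatum L 3 H').Local v)]
    [∀ γ : ((cmDatum L 3 H').Local v), MeasurableSpace (((cmDatum L 3 H').Local v) ⧸ Subgroup.centralizer ({γ} : Set ((cmDatum L 3 H').Local v)))]
    [∀ γ : ((cmDatum L 3 H').Local v), BorelSpace (((cmDatum L 3 H').Local v) ⧸ Subgroup.centralizer ({γ} : Set ((cmDatum L 3 H').Local v)))]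
    (νG : Measure ((cmDatum L 3 H').Local v)) [νG.IsHaarMeasure] [νG.IsMulRightInvariant]
    {mG : OrbitalMeasureFamily ((cmDatum L 3 H').Local v)}
    (hmG : mG.IsCanonical (fun γ => IsRegularElt (γ.val : GL (Fin 3) (UnitaryGroup.LocalRing L v))) νG)
    -- the depth-zero piece
    (g : ((cmDatum L 3 H').Local v) → ℂ) (hg : IsLocSmooth g) (hgK : tsupport g ⊆ (cmLocalIntegralLevel L 3 H' v : Set ((cmDatum L 3 H').Local v)))
    (hginv : ∀ u ∈ cmLocalIntegralLevel L 3 H' v, ∀ x, g (u * x * u⁻¹) = g x)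
    (c : ℕ → ℂ)
    (hc : ∀ k ∈ cmLocalIntegralLevel L 3 H' v,
      (redMat (((k.val : GL (Fin 3) (UnitaryGroup.LocalRing L v)).val.map (Pi.evalRingHom (fun w' : PlacesOver L v => w'.1.adicCompletion L) w))) - 1) ^ 3 = 0 →
      g k = c (redMat (((k.val : GL (Fin 3) (UnitaryGroup.LocalRing L v)).val.map (Pi.evalRingHom (fun w' : PlacesOver L v => w'.1.adicCompletion L) w))) - 1).rank)
    -- the trace literal
    {b x₁ x₂ x₃ : LocalRing L v} (hb : b + conjLocal L (IsCMField.complexConj L) v b = 1)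
    (hx₁ : conjLocal L (IsCMField.complexConj L) v x₁ * x₁ = 1) (hx₂ : conjLocal L (IsCMField.complexConj L) v x₂ * x₂ = 1)
    (hx₃ : conjLocal L (IsCMField.complexConj L) v x₃ * x₃ = 1) (h₁₂ : x₁ ≠ x₂) (h₂₃ : x₂ ≠ x₃) (h₁₃ : x₁ ≠ x₃)
    (Tl : GL (Fin 3) (LocalRing L v))
    (ψ : ↥(UnitaryGroup.«local» L (IsCMField.complexConj L) 3 H' v) ≃ₜ*
        ↥(UnitaryGroup.«local» L (IsCMField.complexConj L) 3 (Matrix.of fun i j : Fin 3 => if i.val + j.val + 1 = 3 then (1 : L) else 0) v))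
    (t : (cmDatum L 3 H').Local v)
    (hψ : ∀ g, (ψ g).val = Tl * g.val * Tl⁻¹)
    (hlit : (ψ t).val.val = !![x₁ * conjLocal L (IsCMField.complexConj L) v b + x₃ * b, 0, x₁ - x₃; 0, x₂, 0;
      b * conjLocal L (IsCMField.complexConj L) v b * (x₁ - x₃), 0, x₁ * b + x₃ * conjLocal L (IsCMField.complexConj L) v b])
    (hd₁ : Valued.v (x₁ w - 1) < 1) (hd₂ : Valued.v (x₂ w - 1) < 1) (hd₃ : Valued.v (x₃ w - 1) < 1) :
    classOrbitalIntegral mG g (ConjClasses.mk t) =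
      (νG.real (cmLocalIntegralLevel L 3 H' v : Set ((cmDatum L 3 H').Local v)) : ℂ) *
        (c 0 * ({q : (cmDatum L 3 H').Local v ⧸ cmLocalIntegralLevel L 3 H' v |
            q ∈ MulAction.fixedBy ((cmDatum L 3 H').Local v ⧸ cmLocalIntegralLevel L 3 H' v) t ∧
              (redMat ((((q.out⁻¹ * t * q.out : (cmDatum L 3 H').Local v)).val : GL (Fin 3) (LocalRing L v)).val.map
                (Pi.evalRingHom (fun w' : PlacesOver L v => w'.1.adicCompletion L) w)) - 1).rank = 0}.ncard : ℂ) +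
          c 1 * ({q : (cmDatum L 3 H').Local v ⧸ cmLocalIntegralLevel L 3 H' v |
            q ∈ MulAction.fixedBy ((cmDatum L 3 H').Local v ⧸ cmLocalIntegralLevel L 3 H' v) t ∧
              (redMat ((((q.out⁻¹ * t * q.out : (cmDatum L 3 H').Local v)).val : GL (Fin 3) (LocalRing L v)).val.map
                (Pi.evalRingHom (fun w' : PlacesOver L v => w'.1.adicCompletion L) w)) - 1).rank = 1}.ncard : ℂ) +
          c 2 * ({q : (cmDatum L 3 H').Local v ⧸ cmLocalIntegralLevel L 3 H' v |
            q ∈ MulAction.fixedBy ((cmDatum L 3 H').Local v ⧸ cmLocalIntegralLevel L 3 H' v) t ∧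
              (redMat ((((q.out⁻¹ * t * q.out : (cmDatum L 3 H').Local v)).val : GL (Fin 3) (LocalRing L v)).val.map
                (Pi.evalRingHom (fun w' : PlacesOver L v => w'.1.adicCompletion L) w)) - 1).rank = 2}.ncard : ℂ)) := by
  have hH'c : (H'.map (cmConjRingHom L))ᵀ = H' := by
    have e1 : H'.map (cmConjRingHom L) = H'.map (IsCMField.complexConj L) := by
      ext i j; simp [Matrix.map_apply, cmConjRingHom_apply]
    rw [e1]; exact hH'
  have hdet : H'.det ≠ 0 := (Matrix.isUnit_iff_isUnit_det _ |>.1 hH'u).ne_zero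
  have hreg : IsRegularElt (t.val : GL (Fin 3) (LocalRing L v)) :=
    isRegularElt_of_congr_traceTorusElt L H' w hw hb h₁₂ h₂₃ h₁₃ Tl ψ t hψ hlit
  haveI : CompactSpace (Subgroup.centralizer ({t} : Set ((cmDatum L 3 H').Local v))) :=
    compactSpace_centralizer_of_congr_traceTorusElt L H' hH' hH'u w hw hb hx₁ hx₂ hx₃ h₁₂ h₂₃ h₁₃ Tl ψ t hψ hlit
  have ht := deep_of_congr_traceTorusElt L H' w hb Tl ψ t hψ hlit hd₁ hd₂ hd₃
  exact classOrbitalIntegral_eq_mul_strata_three_of_deep L v w hw νG hH'c hdet hmG t hreg ht g hg hgK hginv c hc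

end Literature.NumberTheory.Rogawski1990

end
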